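import Literature.Topology.FourManifolds.TautFoliationsDiscFoliation
import Literature.Topology.PlanarFoliations.OfChartsPlaques
import HarnessLib

/-!
# The closed leaves around a roof centre of the contour foliation

Topic: sequel to `TautFoliationsDiscFoliation.lean`. In a roof square `Q` of a checkerboard
datum, for a level `h` strictly between the boundary heights and the apex, the contour line
`{H_Q = h}` is a closed curve `levelPt '' ∂Q` inside the open square, off the centre; it is a
**compact leaf of the contour foliation**, and (for the datum of a cone position) the filled
map sends it into a single plaque of the box of `Q`. These are the closed leaves
null-homotopic in their leaves from which the Camacho–Lins Neto process `V₀ ⊂ V₁ ⊂ ⋯` starts.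

* `Grid.isConnected_sphere` (**proved**): the boundary of a grid square is connected;
  `Grid.vertices_disjoint_ball`;
* `CheckerboardDatum.levelSet q h` (**definition**) with `levelSet_eq_image`,
  `isCompact_levelSet`, `isConnected_levelSet`, `levelSet_subset_X₀`;
* `CheckerboardDatum.leaf_eq_levelSet` (**proved**): for `y` on it, the leaf of the contour
  foliation through `y` is (the preimage in `X₀` of) the level set; `isCompact_leaf_levelSet`;
* the same for floor squares (`…_floor`, levels between the apex and the boundary heights);
* `ConePosition.fill_levelSet` (**proved**): `fill` maps the level set into the plaque of
  `box q` at height `h`.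

All statements are [folklore].
-/

noncomputable section

open Set Filter Metric Topology
open Literature.Topology.PlanarFoliations

namespace Literature.Topology.FourManifolds

open ConeSquare SquareGrid

namespace SquareGrid.Grid

variable (g : Grid)

/-- **The boundary of a grid square is connected** (union of its four edges, chained at the
corners). [folklore] -/
theorem isConnected_sphere (q : Fin g.n × Fin g.n) : IsConnected (sphere (g.centre q) g.ℓ) := by
  have hℓ := g.hℓ
  set E : Fin 4 → Set (ℝ × ℝ) := fun k ↦ g.edge q k '' Icc 0 (2 * g.ℓ) with hE
  have hEc : ∀ k, IsConnected (E k) := fun k ↦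
    (isConnected_Icc (by linarith)).image _ (g.continuous_edge q k).continuousOn
  have hEs : ∀ k, E k ⊆ sphere (g.centre q) g.ℓ := by
    rintro k _ ⟨s, hs, rfl⟩; exact g.edge_mem_sphere q k hs
  have h0 : (0 : ℝ) ∈ Icc 0 (2 * g.ℓ) := ⟨le_rfl, by linarith⟩
  have h2 : 2 * g.ℓ ∈ Icc 0 (2 * g.ℓ) := ⟨by linarith, le_rfl⟩
  obtain ⟨c02, c03, c21, c13⟩ := g.edge_corners q
  -- chain: E 0 ∪ E 2 (corner 0↔2), then E 1 (corner 2↔1), then E 3 (corner 0↔3)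
  have hU1 : IsConnected (E 0 ∪ E 2) :=
    IsConnected.union ⟨g.edge q 0 0, ⟨0, h0, rfl⟩, ⟨0, h0, c02.symm⟩⟩ (hEc 0) (hEc 2)
  have hU2 : IsConnected (E 0 ∪ E 2 ∪ E 1) :=
    IsConnected.union ⟨g.edge q 2 (2 * g.ℓ), Or.inr ⟨_, h2, rfl⟩, ⟨0, h0, c21.symm⟩⟩ hU1 (hEc 1)
  have hU3 : IsConnected (E 0 ∪ E 2 ∪ E 1 ∪ E 3) :=
    IsConnected.union ⟨g.edge q 0 (2 * g.ℓ), Or.inl (Or.inl ⟨_, h2, rfl⟩), ⟨0, h0, c03.symm⟩⟩ hU2 (hEc 3)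
  have heq : E 0 ∪ E 2 ∪ E 1 ∪ E 3 = sphere (g.centre q) g.ℓ := by
    apply Subset.antisymm
    · intro y hy
      rcases hy with ((hy | hy) | hy) | hy <;> exact hEs _ hy
    · intro y hy
      obtain ⟨k, s, hs, rfl⟩ := g.exists_edge_eq_of_mem_sphere hy
      fin_cases k
      · exact Or.inl (Or.inl (Or.inl ⟨s, hs, rfl⟩))
      · exact Or.inl (Or.inr ⟨s, hs, rfl⟩)
      · exact Or.inl (Or.inl (Or.inr ⟨s, hs, rfl⟩))
      · exact Or.inr ⟨s, hs, rfl⟩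
  rwa [heq] at hU3

/-- **The vertices miss the open squares.** [folklore] -/
theorem vertices_disjoint_ball (q : Fin g.n × Fin g.n) : Disjoint g.vertices (ball (g.centre q) g.ℓ) := by
  rw [disjoint_left]
  rintro _ ⟨p, -, rfl⟩ hb
  have hℓ := g.hℓ
  rw [mem_ball, Prod.dist_eq, Real.dist_eq, Real.dist_eq, centre_fst, centre_snd, max_lt_iff] at hb
  obtain ⟨h1, -⟩ := hb
  simp only at h1
  rw [show g.a.1 + 2 * ((p.1 : ℕ) : ℝ) * g.ℓ - (g.a.1 + (2 * ((q.1 : ℕ) : ℝ) + 1) * g.ℓ) =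
    (2 * ((p.1 : ℕ) : ℝ) - 2 * ((q.1 : ℕ) : ℝ) - 1) * g.ℓ by ring, abs_mul, abs_of_pos hℓ] at h1
  have h2 : |2 * ((p.1 : ℕ) : ℝ) - 2 * ((q.1 : ℕ) : ℝ) - 1| < 1 := by
    by_contra hge; push Not at hge; nlinarith
  have hint : ∃ k : ℤ, (2 * ((p.1 : ℕ) : ℝ) - 2 * ((q.1 : ℕ) : ℝ) - 1) = (2 * k + 1 : ℤ) :=
    ⟨(p.1 : ℕ) - (q.1 : ℕ) - 1, by push_cast; ring⟩
  obtain ⟨k, hk⟩ := hint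
  rw [hk, ← Int.cast_abs] at h2
  have h3 : |2 * k + 1| < 1 := by exact_mod_cast h2
  rw [abs_lt] at h3
  omega

/-- Open squares lie in the open big square. [folklore] -/
theorem ball_subset_ball_bigCentre (q : Fin g.n × Fin g.n) : ball (g.centre q) g.ℓ ⊆ ball g.bigCentre (g.n * g.ℓ) := by
  have h : ball (g.centre q) g.ℓ ⊆ interior g.S :=
    interior_maximal ((ball_subset_closedBall).trans (g.sq_subset_S q)) isOpen_ball
  rwa [Grid.S, interior_closedBall _ (by have := g.hℓ; have := g.hn; positivity : (g.n : ℝ) * g.ℓ ≠ 0)] at h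

end SquareGrid.Grid

/-! ## Level sets in a roof square -/

namespace CheckerboardDatum

variable {g : Grid} (D : CheckerboardDatum g)

/-- The contour line of level `h` in the open square of `q`, off the centre. [folklore] -/
def levelSet (q : Fin g.n × Fin g.n) (h : ℝ) : Set (ℝ × ℝ) :=
  {y | y ∈ ball (g.centre q) g.ℓ ∧ y ≠ g.centre q ∧ D.H q y = h}

section Roof

variable {q : Fin g.n × Fin g.n} {h : ℝ} (hr : D.roof q) (hlo : ∀ y ∈ sphere (g.centre q) g.ℓ, D.ψ q y < h) (hhi : h < D.m q)
include hr hlo hhi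

/-- **The contour line of a roof square at a level between the boundary heights and the apex
is the closed curve `levelPt '' ∂Q`.** [folklore] -/
theorem levelSet_eq_image :
    D.levelSet q h = (fun y ↦ levelPt (g.centre q) (D.m q) (D.ψ q) y h) '' sphere (g.centre q) g.ℓ := by
  have hℓ := g.hℓ
  have hm := D.lt_apex q hr
  ext x
  constructor
  · rintro ⟨hxb, hxc, hxh⟩
    refine ⟨proj (g.centre q) g.ℓ x, proj_mem_sphere hℓ x, ?_⟩
    exact (eq_levelPt_of_coneHt_eq hℓ hm hxh).symm
  · rintro ⟨y, hy, rfl⟩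
    refine ⟨(levelPt_mem_ball_iff hℓ hy (hm y hy) hhi.le).2 (hlo y hy), ?_, coneHt_levelPt hℓ hy (hm y hy) hhi.le⟩
    intro heq
    exact absurd ((levelPt_eq_center_iff hℓ hy (hm y hy) hhi.le).1 heq) (ne_of_lt hhi)

/-- The contour line is compact. [folklore] -/
theorem isCompact_levelSet : IsCompact (D.levelSet q h) := by
  rw [D.levelSet_eq_image hr hlo hhi]
  refine (isCompact_sphere _ _).image_of_continuousOn ?_
  exact (continuousOn_levelPt (D.lt_apex q hr) (D.cont q)).comp (continuousOn_id.prodMk continuousOn_const)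
    fun y hy ↦ ⟨hy, mem_univ _⟩

/-- The contour line is connected. [folklore] -/
theorem isConnected_levelSet : IsConnected (D.levelSet q h) := by
  rw [D.levelSet_eq_image hr hlo hhi]
  refine (g.isConnected_sphere q).image _ ?_
  exact (continuousOn_levelPt (D.lt_apex q hr) (D.cont q)).comp (continuousOn_id.prodMk continuousOn_const)
    fun y hy ↦ ⟨hy, mem_univ _⟩

omit hr hlo hhi in
/-- The contour line lies in the carrier. [folklore] -/
theorem levelSet_subset_X₀ : D.levelSet q h ⊆ (g.X₀ : Set (ℝ × ℝ)) := by
  rintro y ⟨hyb, hyc, -⟩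
  refine (g.mem_X₀_iff).2 ⟨g.ball_subset_ball_bigCentre q hyb, ?_, fun hv ↦ disjoint_left.1 (g.vertices_disjoint_ball q) hv hyb⟩
  rintro ⟨q₁, hq₁⟩
  by_cases hqq : q₁ = q
  · subst hqq; exact hyc hq₁.symm
  · have h1 : y ∈ ball (g.centre q₁) g.ℓ := by rw [← hq₁]; exact mem_ball_self g.hℓ
    exact disjoint_left.1 (g.ball_disjoint_sq hqq) h1 (ball_subset_closedBall hyb)

/-- **Plaque invariance of the contour line**: a plaque of the contour foliation through a point
of the contour line lies in it. [folklore] -/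
theorem plaque_subset_levelSet {e : OpenPartialHomeomorph g.X₀ (ℝ × ℝ)} (he : e ∈ D.foliation.atlas) {z w : g.X₀}
    (hz : (z : ℝ × ℝ) ∈ D.levelSet q h) (hze : z ∈ e.source) (hwe : w ∈ e.source) (hzw : (e z).2 = (e w).2) :
    (w : ℝ × ℝ) ∈ D.levelSet q h := by
  classical
  haveI := g.nonempty_X₀
  have hℓ := g.hℓ
  obtain ⟨c, ⟨ĉ, hĉ, rfl⟩, p, r, hrr, hbox, rfl⟩ := he
  -- the (connected) plaque through `z`
  set Pl := {v : g.X₀ | v ∈ (renormBox (ĉ.subtypeRestr g.nonempty_X₀) p r hrr).source ∧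
    (renormBox (ĉ.subtypeRestr g.nonempty_X₀) p r hrr v).2 = (renormBox (ĉ.subtypeRestr g.nonempty_X₀) p r hrr z).2} with hPl
  have hPlc : IsConnected Pl := PreAtlas.isConnected_plaque hbox hze
  have hwPl : w ∈ Pl := ⟨hwe, hzw.symm⟩
  have hzPl : z ∈ Pl := ⟨hze, rfl⟩
  -- heights of `ĉ` are constant on the plaque
  have hht : ∀ v ∈ Pl, (ĉ v).2 = (ĉ z).2 := fun v hv ↦ by
    have := (renormBox_snd_eq_iff hv.1 hze).1 hv.2
    exact this
  have hsrc : ∀ v ∈ Pl, (v : ℝ × ℝ) ∈ ĉ.source := fun v hv ↦ by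
    have := renormBox_source_subset _ _ _ _ hv.1
    rwa [OpenPartialHomeomorph.subtypeRestr_source] at this
  obtain ⟨hzb, hzc, hzh⟩ := hz
  -- the plaque stays in the open square of `q`
  have hball : ∀ v ∈ Pl, (v : ℝ × ℝ) ∈ ball (g.centre q) g.ℓ := by
    rcases hĉ with ⟨q₁, h₁, k, rfl⟩ | ⟨q₁, h₁, k, rfl⟩ | ⟨q₁, q₂, T, hn, hr₁, hf₂, E, rfl⟩
    · intro v hv
      have h' := D.roofChart_source_subset h₁ k (hsrc v hv)
      rwa [g.eq_of_mem_ball_of_mem_ball hzb (D.roofChart_source_subset h₁ k (hsrc z hzPl))] at h'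
    · intro v hv
      have h' := D.floorChart_source_subset h₁ k (hsrc v hv)
      rwa [g.eq_of_mem_ball_of_mem_ball hzb (D.floorChart_source_subset h₁ k (hsrc z hzPl))] at h'
    · -- edge chart: `z` is on the roof side `q₁ = q`; the plaque misses the open edge
      have hq : q₁ = q := by
        rcases E.source_subset (hsrc z hzPl) with (hb | hb) | hedge
        · exact g.eq_of_mem_ball_of_mem_ball hzb hb
        · exact absurd ((g.eq_of_mem_ball_of_mem_ball hzb hb) ▸ hr) hf₂
        · exact absurd hzb (g.not_mem_ball_of_mem_openEdge hedge)
      subst hq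
      have hzval : (E.chart z).2 = h := by
        rw [E.chart_snd_of_mem_ball_left hzb]; exact hzh
      -- the plaque avoids the open edge and the floor side
      have hside : ∀ v ∈ Pl, (v : ℝ × ℝ) ∈ ball (g.centre q₁) g.ℓ ∨ (v : ℝ × ℝ) ∈ ball (g.centre q₂) g.ℓ := by
        intro v hv
        rcases E.source_subset (hsrc v hv) with (hb | hb) | hedge
        · exact Or.inl hb
        · exact Or.inr hb
        · exfalso
          -- on the edge the height is the boundary height `< h`
          have h1 : (E.chart v).2 = D.H q₁ v := by
            rw [E.chart_snd_eq_canonHt (hsrc v hv), EdgeDataAt.canonHt, if_pos]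
            · rfl
            · have := hedge.1; rw [mem_sphere] at this; exact this.le
          have h2 : D.H q₁ v = D.ψ q₁ v := coneHt_of_mem_sphere hℓ hedge.1
          have h3 := hht v hv
          rw [h1, h2, hzval] at h3
          exact absurd h3 (ne_of_lt (hlo _ hedge.1))
      -- connectedness: the plaque lies on one side
      have hpre : IsPreconnected (((↑) : g.X₀ → ℝ × ℝ) '' Pl) := hPlc.isPreconnected.image _ continuous_subtype_val.continuousOn
      intro v hv
      by_contra hvn
      have hv₂ : (v : ℝ × ℝ) ∈ ball (g.centre q₂) g.ℓ := (hside v hv).resolve_left hvn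
      have hne : q₂ ≠ q₁ := fun h' ↦ hf₂ (h' ▸ hr)
      obtain ⟨u, hu, hu₁, hu₂⟩ := hpre _ _ isOpen_ball isOpen_ball
        (by rintro _ ⟨v', hv', rfl⟩; exact hside v' hv') ⟨z, ⟨z, hzPl, rfl⟩, hzb⟩ ⟨v, ⟨v, hv, rfl⟩, hv₂⟩
      exact disjoint_left.1 (g.ball_disjoint_sq hne) hu₂ (ball_subset_closedBall hu₁)
  -- on the open square the chart height is an increasing function of `H q`
  obtain ⟨φ, hφ, hrep⟩ := D.rep hĉ q
  have hHw : D.H q w = D.H q z := by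
    have e1 := hrep w ⟨hsrc w hwPl, hball w hwPl⟩
    have e2 := hrep z ⟨hsrc z hzPl, hzb⟩
    have := hht w hwPl
    rw [e1, e2] at this
    exact hφ.injective this
  refine ⟨hball w hwPl, fun hwc ↦ ?_, by rw [hHw, hzh]⟩
  have : D.H q w = D.m q := by rw [hwc]; exact coneHt_center _ _ _ _
  rw [hHw, hzh] at this
  exact absurd this (ne_of_lt hhi)

/-- **The leaf of the contour foliation through a point of the contour line is the contour
line.** [folklore] -/
theorem leaf_eq_levelSet {y : g.X₀} (hy : (y : ℝ × ℝ) ∈ D.levelSet q h) :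
    D.foliation.leaf y = ((↑) : g.X₀ → ℝ × ℝ) ⁻¹' D.levelSet q h := by
  classical
  haveI := g.nonempty_X₀
  apply Subset.antisymm
  · -- plaque invariance
    exact D.foliation.leaf_subset_of_plaque_invariant
      (fun e he z hz w hze hwe hh ↦ D.plaque_subset_levelSet hr hlo hhi he hz hze hwe hh) hy
  · -- connectedness of the contour line and local plaque-chaining through the roof charts
    have hℓ := g.hℓ
    set S : Set g.X₀ := ((↑) : g.X₀ → ℝ × ℝ) ⁻¹' D.levelSet q h with hS
    have hloc : ∀ z ∈ S, ∃ V : Set g.X₀, IsOpen V ∧ z ∈ V ∧ ∀ w ∈ V ∩ S, D.foliation.SamePlaque z w := by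
      intro z hz
      obtain ⟨hzb, hzc, hzh⟩ := hz
      obtain ⟨k, -, hk⟩ := exists_mem_sectorChart_source hℓ (D.lt_apex q hr) (D.cont q) hzb hzc
      have hk' : (z : ℝ × ℝ) ∈ (D.roofChart q hr k).source := hk
      have hĉP : D.IsPlaneChart (D.roofChart q hr k) := Or.inl ⟨q, hr, k, rfl⟩
      have hzs : z ∈ ((D.roofChart q hr k).subtypeRestr g.nonempty_X₀).source := by
        rw [OpenPartialHomeomorph.subtypeRestr_source]; exact hk'
      obtain ⟨r, hrr, hmem, hzr⟩ :=
        D.preAtlas.exists_mem_atlas_of_mem_source (c := (D.roofChart q hr k).subtypeRestr g.nonempty_X₀)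
          ⟨D.roofChart q hr k, hĉP, rfl⟩ hzs
      refine ⟨_, (renormBox _ _ r hrr).open_source, hzr, fun w hw ↦ ⟨_, hmem, hzr, hw.1, ?_⟩⟩
      rw [renormBox_snd_eq_iff hzr hw.1]
      change (D.roofChart q hr k z).2 = (D.roofChart q hr k w).2
      rw [D.roofChart_snd hr k, D.roofChart_snd hr k, hzh, hw.2.2.2]
    choose! V hVo hVz hV using hloc
    -- `S` is preconnected (homeomorphic image of the connected contour line)
    have hSc : IsPreconnected S := by
      have himg : ((↑) : g.X₀ → ℝ × ℝ) '' S = D.levelSet q h := by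
        rw [hS, image_preimage_eq_inter_range, Subtype.range_coe]
        exact inter_eq_left.2 (D.levelSet_subset_X₀)
      have := (D.isConnected_levelSet hr hlo hhi).isPreconnected
      rw [← himg] at this
      exact (Topology.IsInducing.subtypeVal.isPreconnected_image).1 this
    -- the leaf through `y` is open and closed in `S`
    intro w hwS
    by_contra hw
    set O : Set g.X₀ := ⋃ z ∈ {z | z ∈ S ∧ z ∈ D.foliation.leaf y}, V z with hO
    set O' : Set g.X₀ := ⋃ z ∈ {z | z ∈ S ∧ z ∉ D.foliation.leaf y}, V z with hO'
    have hOo : IsOpen O := isOpen_biUnion fun z hz ↦ hVo z hz.1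
    have hO'o : IsOpen O' := isOpen_biUnion fun z hz ↦ hVo z hz.1
    have hcov : S ⊆ O ∪ O' := by
      intro z hz
      by_cases hzl : z ∈ D.foliation.leaf y
      · exact Or.inl (mem_biUnion (show z ∈ {z | z ∈ S ∧ z ∈ D.foliation.leaf y} from ⟨hz, hzl⟩) (hVz z hz))
      · exact Or.inr (mem_biUnion (show z ∈ {z | z ∈ S ∧ z ∉ D.foliation.leaf y} from ⟨hz, hzl⟩) (hVz z hz))
    have hyO : (S ∩ O).Nonempty :=
      ⟨y, hy, mem_biUnion (show y ∈ {z | z ∈ S ∧ z ∈ D.foliation.leaf y} from ⟨hy, D.foliation.mem_leaf_self y⟩) (hVz y hy)⟩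
    have hwO' : (S ∩ O').Nonempty :=
      ⟨w, hwS, mem_biUnion (show w ∈ {z | z ∈ S ∧ z ∉ D.foliation.leaf y} from ⟨hwS, hw⟩) (hVz w hwS)⟩
    obtain ⟨u, huS, huO, huO'⟩ := hSc O O' hOo hO'o hcov hyO hwO'
    rw [hO, mem_iUnion₂] at huO
    rw [hO', mem_iUnion₂] at huO'
    obtain ⟨z, ⟨hzS, hzl⟩, huz⟩ := huO
    obtain ⟨z', ⟨hz'S, hz'l⟩, huz'⟩ := huO'
    have h1 : u ∈ D.foliation.leaf z := Relation.EqvGen.rel _ _ (hV z hzS u ⟨huz, huS⟩)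
    have h2 : u ∈ D.foliation.leaf z' := Relation.EqvGen.rel _ _ (hV z' hz'S u ⟨huz', huS⟩)
    have e1 : D.foliation.leaf z = D.foliation.leaf y := D.foliation.leaf_eq_of_mem hzl
    have e2 : D.foliation.leaf u = D.foliation.leaf z' := D.foliation.leaf_eq_of_mem h2
    have e3 : D.foliation.leaf u = D.foliation.leaf y := by rw [← e1]; exact D.foliation.leaf_eq_of_mem h1
    apply hz'l
    rw [← e3, e2]
    exact D.foliation.mem_leaf_self z'

/-- **The contour lines around a roof centre are compact leaves.** [folklore] -/
theorem isCompact_leaf_levelSet {y : g.X₀} (hy : (y : ℝ × ℝ) ∈ D.levelSet q h) : IsCompact (D.foliation.leaf y) := by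
  rw [D.leaf_eq_levelSet hr hlo hhi hy, Topology.IsInducing.subtypeVal.isCompact_iff]
  convert D.isCompact_levelSet hr hlo hhi using 1
  ext x
  constructor
  · rintro ⟨v, hv, rfl⟩; exact hv
  · intro hx; exact ⟨⟨x, D.levelSet_subset_X₀ hx⟩, hx, rfl⟩

end Roof

section Floor

variable {q : Fin g.n × Fin g.n} {h : ℝ} (hr : ¬ D.roof q) (hlo : D.m q < h) (hhi : ∀ y ∈ sphere (g.centre q) g.ℓ, h < D.ψ q y)
include hr hlo hhi

/-- **The contour line of a floor square at a level between the apex and the boundary heights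
is the closed curve `levelPt '' ∂Q`.** [folklore] -/
theorem levelSet_eq_image_floor :
    D.levelSet q h = (fun y ↦ levelPt (g.centre q) (D.m q) (D.ψ q) y h) '' sphere (g.centre q) g.ℓ := by
  have hℓ := g.hℓ
  have hm := D.apex_lt q hr
  ext x
  constructor
  · rintro ⟨hxb, hxc, hxh⟩
    refine ⟨proj (g.centre q) g.ℓ x, proj_mem_sphere hℓ x, ?_⟩
    exact (eq_levelPt_of_coneHt_eq_floor hℓ hm hxh).symm
  · rintro ⟨y, hy, rfl⟩
    refine ⟨(levelPt_mem_ball_iff_floor hℓ hy (hm y hy) hlo.le).2 (hhi y hy), ?_, coneHt_levelPt_floor hℓ hy (hm y hy) hlo.le⟩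
    intro heq
    have h1 : coneHt (g.centre q) g.ℓ (D.m q) (D.ψ q) (levelPt (g.centre q) (D.m q) (D.ψ q) y h) = h :=
      coneHt_levelPt_floor hℓ hy (hm y hy) hlo.le
    have h2 : levelPt (g.centre q) (D.m q) (D.ψ q) y h = g.centre q := heq
    rw [h2, coneHt_center] at h1
    exact absurd h1 (ne_of_lt hlo)

omit hlo hhi in
/-- Continuity of the floor level map along the boundary. [folklore] -/
theorem continuousOn_levelPt_floor :
    ContinuousOn (fun y ↦ levelPt (g.centre q) (D.m q) (D.ψ q) y h) (sphere (g.centre q) g.ℓ) := by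
  have h1 := (continuousOn_levelPt (c := g.centre q) (m := -D.m q) (ψ := fun y ↦ -D.ψ q y)
    (fun p hp ↦ by linarith [D.apex_lt q hr p hp]) (D.cont q).neg).comp
    (continuousOn_id.prodMk (continuousOn_const (c := -h))) fun y hy ↦ ⟨hy, mem_univ _⟩
  refine h1.congr fun y _ ↦ ?_
  simp only [Function.comp_apply, id_eq]
  exact (levelPt_neg (g.centre q) (D.m q) (D.ψ q) y h).symm

/-- The contour line is compact. [folklore] -/
theorem isCompact_levelSet_floor : IsCompact (D.levelSet q h) := by
  rw [D.levelSet_eq_image_floor hr hlo hhi]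
  exact (isCompact_sphere _ _).image_of_continuousOn (D.continuousOn_levelPt_floor hr)

/-- The contour line is connected. [folklore] -/
theorem isConnected_levelSet_floor : IsConnected (D.levelSet q h) := by
  rw [D.levelSet_eq_image_floor hr hlo hhi]
  exact (g.isConnected_sphere q).image _ (D.continuousOn_levelPt_floor hr)

/-- **Plaque invariance of the contour line**: a plaque of the contour foliation through a point
of the contour line lies in it. [folklore] -/
theorem plaque_subset_levelSet_floor {e : OpenPartialHomeomorph g.X₀ (ℝ × ℝ)} (he : e ∈ D.foliation.atlas) {z w : g.X₀}
    (hz : (z : ℝ × ℝ) ∈ D.levelSet q h) (hze : z ∈ e.source) (hwe : w ∈ e.source) (hzw : (e z).2 = (e w).2) :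
    (w : ℝ × ℝ) ∈ D.levelSet q h := by
  classical
  haveI := g.nonempty_X₀
  have hℓ := g.hℓ
  obtain ⟨c, ⟨ĉ, hĉ, rfl⟩, p, r, hrr, hbox, rfl⟩ := he
  -- the (connected) plaque through `z`
  set Pl := {v : g.X₀ | v ∈ (renormBox (ĉ.subtypeRestr g.nonempty_X₀) p r hrr).source ∧
    (renormBox (ĉ.subtypeRestr g.nonempty_X₀) p r hrr v).2 = (renormBox (ĉ.subtypeRestr g.nonempty_X₀) p r hrr z).2} with hPl
  have hPlc : IsConnected Pl := PreAtlas.isConnected_plaque hbox hze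
  have hwPl : w ∈ Pl := ⟨hwe, hzw.symm⟩
  have hzPl : z ∈ Pl := ⟨hze, rfl⟩
  -- heights of `ĉ` are constant on the plaque
  have hht : ∀ v ∈ Pl, (ĉ v).2 = (ĉ z).2 := fun v hv ↦ by
    have := (renormBox_snd_eq_iff hv.1 hze).1 hv.2
    exact this
  have hsrc : ∀ v ∈ Pl, (v : ℝ × ℝ) ∈ ĉ.source := fun v hv ↦ by
    have := renormBox_source_subset _ _ _ _ hv.1
    rwa [OpenPartialHomeomorph.subtypeRestr_source] at this
  obtain ⟨hzb, hzc, hzh⟩ := hz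
  -- the plaque stays in the open square of `q`
  have hball : ∀ v ∈ Pl, (v : ℝ × ℝ) ∈ ball (g.centre q) g.ℓ := by
    rcases hĉ with ⟨q₁, h₁, k, rfl⟩ | ⟨q₁, h₁, k, rfl⟩ | ⟨q₁, q₂, T, hn, hr₁, hf₂, E, rfl⟩
    · intro v hv
      have h' := D.roofChart_source_subset h₁ k (hsrc v hv)
      rwa [g.eq_of_mem_ball_of_mem_ball hzb (D.roofChart_source_subset h₁ k (hsrc z hzPl))] at h'
    · intro v hv
      have h' := D.floorChart_source_subset h₁ k (hsrc v hv)
      rwa [g.eq_of_mem_ball_of_mem_ball hzb (D.floorChart_source_subset h₁ k (hsrc z hzPl))] at h'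
    · -- edge chart: `z` is on the floor side `q₂ = q`; the plaque misses the open edge
      have hq : q₂ = q := by
        rcases E.source_subset (hsrc z hzPl) with (hb | hb) | hedge
        · exact absurd hr₁ ((g.eq_of_mem_ball_of_mem_ball hzb hb) ▸ hr)
        · exact g.eq_of_mem_ball_of_mem_ball hzb hb
        · exact absurd hzb (g.not_mem_ball_of_mem_openEdge hedge)
      subst hq
      have hzval : (E.chart z).2 = D.σ q₁ q₂ h := by
        rw [E.chart_snd_of_mem_ball_right hzb]; exact congrArg _ hzh
      -- the plaque avoids the open edge and the roof side
      have hside : ∀ v ∈ Pl, (v : ℝ × ℝ) ∈ ball (g.centre q₁) g.ℓ ∨ (v : ℝ × ℝ) ∈ ball (g.centre q₂) g.ℓ := by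
        intro v hv
        rcases E.source_subset (hsrc v hv) with (hb | hb) | hedge
        · exact Or.inl hb
        · exact Or.inr hb
        · exfalso
          -- on the edge the height is `ψ q₁ = σ (ψ q₂) > σ h`
          have h1 : (E.chart v).2 = D.H q₁ v := by
            rw [E.chart_snd_eq_canonHt (hsrc v hv), EdgeDataAt.canonHt, if_pos]
            · rfl
            · have := hedge.1; rw [mem_sphere] at this; exact this.le
          have h2 : D.H q₁ v = D.ψ q₁ v := coneHt_of_mem_sphere hℓ hedge.1
          have h3 := hht v hv
          rw [h1, h2, hzval, D.compat q₁ q₂ hn hr₁ hr v ⟨hedge.1, hedge.2.1⟩] at h3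
          exact absurd ((D.σ q₁ q₂).injective h3) (ne_of_gt (hhi _ hedge.2.1))
      -- connectedness: the plaque lies on one side
      have hpre : IsPreconnected (((↑) : g.X₀ → ℝ × ℝ) '' Pl) := hPlc.isPreconnected.image _ continuous_subtype_val.continuousOn
      intro v hv
      by_contra hvn
      have hv₁ : (v : ℝ × ℝ) ∈ ball (g.centre q₁) g.ℓ := (hside v hv).resolve_right hvn
      have hne : q₁ ≠ q₂ := fun h' ↦ hr (h' ▸ hr₁)
      obtain ⟨u, hu, hu₁, hu₂⟩ := hpre _ _ isOpen_ball isOpen_ball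
        (by rintro _ ⟨v', hv', rfl⟩; exact (hside v' hv').symm) ⟨z, ⟨z, hzPl, rfl⟩, hzb⟩ ⟨v, ⟨v, hv, rfl⟩, hv₁⟩
      exact disjoint_left.1 (g.ball_disjoint_sq hne) hu₂ (ball_subset_closedBall hu₁)
  -- on the open square the chart height is an increasing function of `H q`
  obtain ⟨φ, hφ, hrep⟩ := D.rep hĉ q
  have hHw : D.H q w = D.H q z := by
    have e1 := hrep w ⟨hsrc w hwPl, hball w hwPl⟩
    have e2 := hrep z ⟨hsrc z hzPl, hzb⟩
    have := hht w hwPl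
    rw [e1, e2] at this
    exact hφ.injective this
  refine ⟨hball w hwPl, fun hwc ↦ ?_, by rw [hHw, hzh]⟩
  have : D.H q w = D.m q := by rw [hwc]; exact coneHt_center _ _ _ _
  rw [hHw, hzh] at this
  exact absurd this (ne_of_gt hlo)

/-- **The leaf of the contour foliation through a point of the contour line is the contour
line.** [folklore] -/
theorem leaf_eq_levelSet_floor {y : g.X₀} (hy : (y : ℝ × ℝ) ∈ D.levelSet q h) :
    D.foliation.leaf y = ((↑) : g.X₀ → ℝ × ℝ) ⁻¹' D.levelSet q h := by
  classical
  haveI := g.nonempty_X₀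
  apply Subset.antisymm
  · -- plaque invariance
    exact D.foliation.leaf_subset_of_plaque_invariant
      (fun e he z hz w hze hwe hh ↦ D.plaque_subset_levelSet_floor hr hlo hhi he hz hze hwe hh) hy
  · -- connectedness of the contour line and local plaque-chaining through the roof charts
    have hℓ := g.hℓ
    set S : Set g.X₀ := ((↑) : g.X₀ → ℝ × ℝ) ⁻¹' D.levelSet q h with hS
    have hloc : ∀ z ∈ S, ∃ V : Set g.X₀, IsOpen V ∧ z ∈ V ∧ ∀ w ∈ V ∩ S, D.foliation.SamePlaque z w := by
      intro z hz
      obtain ⟨hzb, hzc, hzh⟩ := hz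
      obtain ⟨k, -, hk⟩ := exists_mem_floorSectorChart_source hℓ (D.apex_lt q hr) (D.cont q) hzb hzc
      have hk' : (z : ℝ × ℝ) ∈ (D.floorChart q hr k).source := hk
      have hĉP : D.IsPlaneChart (D.floorChart q hr k) := Or.inr (Or.inl ⟨q, hr, k, rfl⟩)
      have hzs : z ∈ ((D.floorChart q hr k).subtypeRestr g.nonempty_X₀).source := by
        rw [OpenPartialHomeomorph.subtypeRestr_source]; exact hk'
      obtain ⟨r, hrr, hmem, hzr⟩ :=
        D.preAtlas.exists_mem_atlas_of_mem_source (c := (D.floorChart q hr k).subtypeRestr g.nonempty_X₀)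
          ⟨D.floorChart q hr k, hĉP, rfl⟩ hzs
      refine ⟨_, (renormBox _ _ r hrr).open_source, hzr, fun w hw ↦ ⟨_, hmem, hzr, hw.1, ?_⟩⟩
      rw [renormBox_snd_eq_iff hzr hw.1]
      change (D.floorChart q hr k z).2 = (D.floorChart q hr k w).2
      rw [D.floorChart_snd hr k, D.floorChart_snd hr k, hzh, hw.2.2.2]
    choose! V hVo hVz hV using hloc
    -- `S` is preconnected (homeomorphic image of the connected contour line)
    have hSc : IsPreconnected S := by
      have himg : ((↑) : g.X₀ → ℝ × ℝ) '' S = D.levelSet q h := by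
        rw [hS, image_preimage_eq_inter_range, Subtype.range_coe]
        exact inter_eq_left.2 (D.levelSet_subset_X₀)
      have := (D.isConnected_levelSet_floor hr hlo hhi).isPreconnected
      rw [← himg] at this
      exact (Topology.IsInducing.subtypeVal.isPreconnected_image).1 this
    -- the leaf through `y` is open and closed in `S`
    intro w hwS
    by_contra hw
    set O : Set g.X₀ := ⋃ z ∈ {z | z ∈ S ∧ z ∈ D.foliation.leaf y}, V z with hO
    set O' : Set g.X₀ := ⋃ z ∈ {z | z ∈ S ∧ z ∉ D.foliation.leaf y}, V z with hO'
    have hOo : IsOpen O := isOpen_biUnion fun z hz ↦ hVo z hz.1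
    have hO'o : IsOpen O' := isOpen_biUnion fun z hz ↦ hVo z hz.1
    have hcov : S ⊆ O ∪ O' := by
      intro z hz
      by_cases hzl : z ∈ D.foliation.leaf y
      · exact Or.inl (mem_biUnion (show z ∈ {z | z ∈ S ∧ z ∈ D.foliation.leaf y} from ⟨hz, hzl⟩) (hVz z hz))
      · exact Or.inr (mem_biUnion (show z ∈ {z | z ∈ S ∧ z ∉ D.foliation.leaf y} from ⟨hz, hzl⟩) (hVz z hz))
    have hyO : (S ∩ O).Nonempty :=
      ⟨y, hy, mem_biUnion (show y ∈ {z | z ∈ S ∧ z ∈ D.foliation.leaf y} from ⟨hy, D.foliation.mem_leaf_self y⟩) (hVz y hy)⟩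
    have hwO' : (S ∩ O').Nonempty :=
      ⟨w, hwS, mem_biUnion (show w ∈ {z | z ∈ S ∧ z ∉ D.foliation.leaf y} from ⟨hwS, hw⟩) (hVz w hwS)⟩
    obtain ⟨u, huS, huO, huO'⟩ := hSc O O' hOo hO'o hcov hyO hwO'
    rw [hO, mem_iUnion₂] at huO
    rw [hO', mem_iUnion₂] at huO'
    obtain ⟨z, ⟨hzS, hzl⟩, huz⟩ := huO
    obtain ⟨z', ⟨hz'S, hz'l⟩, huz'⟩ := huO'
    have h1 : u ∈ D.foliation.leaf z := Relation.EqvGen.rel _ _ (hV z hzS u ⟨huz, huS⟩)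
    have h2 : u ∈ D.foliation.leaf z' := Relation.EqvGen.rel _ _ (hV z' hz'S u ⟨huz', huS⟩)
    have e1 : D.foliation.leaf z = D.foliation.leaf y := D.foliation.leaf_eq_of_mem hzl
    have e2 : D.foliation.leaf u = D.foliation.leaf z' := D.foliation.leaf_eq_of_mem h2
    have e3 : D.foliation.leaf u = D.foliation.leaf y := by rw [← e1]; exact D.foliation.leaf_eq_of_mem h1
    apply hz'l
    rw [← e3, e2]
    exact D.foliation.mem_leaf_self z'

/-- **The contour lines around a floor centre are compact leaves.** [folklore] -/
theorem isCompact_leaf_levelSet_floor {y : g.X₀} (hy : (y : ℝ × ℝ) ∈ D.levelSet q h) : IsCompact (D.foliation.leaf y) := by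
  rw [D.leaf_eq_levelSet_floor hr hlo hhi hy, Topology.IsInducing.subtypeVal.isCompact_iff]
  convert D.isCompact_levelSet_floor hr hlo hhi using 1
  ext x
  constructor
  · rintro ⟨v, hv, rfl⟩; exact hv
  · intro hx; exact ⟨⟨x, D.levelSet_subset_X₀ hx⟩, hx, rfl⟩

end Floor

end CheckerboardDatum

/-! ## The filled map on the contour lines -/

namespace Foliation.ConePosition

variable {B : Type*} [NormedAddCommGroup B] [NormedSpace ℝ B] {M : Type*} [TopologicalSpace M]
  {F : Foliation B M} {f : ℝ × ℝ → M} {c₀ : ℝ × ℝ} {L : ℝ} {hL : 0 < L} (P : ConePosition F f c₀ hL)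

/-- **The filled map sends a contour line of the square `q` into the plaque of `box q` at its
level.** [folklore] -/
theorem fill_levelSet (ho : F.IsTransverselyOriented) {q : Fin P.n × Fin P.n} {h : ℝ} {y : ℝ × ℝ}
    (hy : y ∈ (P.datum ho).levelSet q h) :
    P.fill P.apex y ∈ (P.box q).source ∧ height (P.box q) (P.fill P.apex y) = h := by
  have hyq : y ∈ P.gr.sq q := ball_subset_closedBall hy.1
  exact ⟨P.fill_mem_source P.apex_spec.1 hyq, by rw [← P.H_eq_height_fill ho hyq]; exact hy.2.2⟩

end Foliation.ConePosition

end Literature.Topology.FourManifolds
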